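import Summits.QuantumFields.YangMills.Theorems.BalabanUVNodesPortZDHistoryFluctuation

/-!
# NODE O port, row PT-A′ helper lane (PTZ-1, gen 3): THE STEP'S MOMENT FUNCTIONAL AS AN EXPECTATION UNDER THE NORMALISED FIBRE LAW, and the SECOND-CUMULANT
# BOOKING of the history channel — `𝓓_{k+1}` EQUALS ITS FIRST-ORDER PERTURBATIVE VALUE (the zero-input fibre expectation of print's curly bracket, at `W` minus at `1`)
# UP TO THE TWO SECOND CUMULANTS (generic over `Node00/ZeroInputStepT`; χ, GF, T, A, E BOUND; the fibre laws DISPLAYED through their defining identity)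

[Balaban1987RG1] = [I] (CMP 109, 1987): (0.19) p. 255–256, (1.6) p. 261, (2.10)–(2.14) pp. 267–268 (the fluctuation integral: «we calculate the integral (2.1) applying the
saddle point method», (2.13) `E^{(k+1)} = log ∫ dμ_{C^{(k)}} χ_k exp[P^{(k)} + {…}]`, (2.14)); [Balaban1988RG2Cluster] = [II] (CMP 116, 1988): (1.9) p. 4 (FTC ∕ expansion in the
decoupled activities), Lemma 3 (2.38) p. 20, p. 21.

Seat `ymgap-nodeO-port-PTZ-1` g3 (prover, HELPER MODE; `--supports stmt-QuantumFields-27930 --as helper`).  Companion of this seat's `…PortZDHistoryFluctuation` (✓p805483: the history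
response is the LOG-MOMENT `log⟨e^{F}⟩^A_V`, `F := E − E(bg_V)`, of the `A`-step).  CRIT-1 Q-5 (β): generic layer, 0 tokens of the χ-cone of record; the NORMALISED FIBRE LAW of the
`A`-step at `V` enters as a measure `μ` DISPLAYED through its defining identity `hμ : ∫ f dμ = T(f·I(A))(V) ∕ T(I(A))(V)` for every `f` (for a kernel transform
`(Tρ)(V) = ∫ ρ dκ_V` this is `μ = Z⁻¹ · I(A)·κ_V`; no measure is constructed here).

WHAT IS PROVED (0 sorry; no `def` ∕ `instance` ∕ `notation`):
* §1 generic cumulant bookkeeping on a probability space (Mathlib only): `jensen_integral_le_log_integral_exp` — JENSEN `∫F ≤ log ∫ e^F`; `log_integral_exp_le_integral_add_var` — TAYLOR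
  `log ∫ e^F ≤ ∫F + ∫(F − ∫F)²` when `|F − ∫F| ≤ 1` a.e.; `abs_log_integral_exp_sub_integral_le_var` — hence `|log ∫ e^F − ∫F| ≤ Var F`.
* §2 the fibre-law interface: `integral_one_of_stepLaw` ∕ `isProbabilityMeasure_of_stepLaw` — `hμ` with `T(I(A))(V) ≠ 0` makes `μ` a probability law; ★ `moment_eq_integral_exp_of_stepLaw`
  — `T(I(A + F))(V) ∕ T(I(A))(V) = ∫ e^{F} dμ` (the step's moment functional IS the exponential moment under the fibre law; `I(A + F) = e^{F}·I(A)` pointwise);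
  `mean_eq_integral_of_stepLaw` — `T(F·I(A))(V) ∕ T(I(A))(V) = ∫ F dμ` (the FIRST-ORDER term); ★ `abs_log_moment_sub_mean_le_var_of_stepLaw` — `|log⟨e^F⟩^A_V − ⟨F⟩^A_V| ≤ Var^A_V(F)`
  when `|F − ⟨F⟩| ≤ 1` `μ`-a.e. and `e^F ∈ L¹(μ)`.
* §3 ★★ `abs_stepOutT_add_sub_sub_firstOrder_le_var` — for `T K k` degree-one homogeneous (gen-0 `hT`), fibre laws `μW` of the `A`-step at `W` and `μ1` at `1`, the `A`-step defined at
  `W`, `1`: `|R_k(A + E)(W) − R_k(A)(W) + E(bg_1) − (⟨E − E(bg_W)⟩_{μW} − ⟨E − E(bg_1)⟩_{μ1})| ≤ Var_{μW}(E) + Var_{μ1}(E)` (centred brackets bounded by 1 a.e., exponential moments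
  finite — displayed); ★★ `abs_dChannel_sub_firstOrder_le_var` — the instance `A := A⁰_k`, `E := 𝐄_k` with `GaugeInvariant A_k` (unit normalisation): THE HISTORY CHANNEL `𝓓_{k+1}(W)`
  EQUALS THE ZERO-INPUT FIBRE EXPECTATION OF PRINT'S CURLY BRACKET AT `W` MINUS AT `1`, UP TO THE TWO SECOND CUMULANTS — print's expansion of (2.13) in the bracket to first
  order ((2.14): the bracket vanishes at zero fluctuation, so its fibre mean and variance are what the cluster expansion of [II] then sizes by `ε₁`; nothing of that sizing is claimed).

HONEST FRAMING.  Elementary probability (`Real.add_one_le_exp`, `Real.abs_exp_sub_one_sub_id_le`, `Real.log_le_sub_one_of_pos`) and log algebra over the tree's definitions; the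
fibre laws, positivity, `GaugeInvariant A_k` and the a.e. bounds are HYPOTHESES displayed by name; NOTHING of Bałaban's estimates asserted, ported or discharged; no named fact
introduced; 26648 ∕ 27930⁸ SIGNED·OPEN (content-gated), 27931 OPEN (RC-3), 27932 CLOSED; K0⁷ ∕ K-Ax OPEN; counts unmoved; finite 𝕋⁴ at fixed ε — NOT continuum ∕ OS ∕ Clay; the
Yang–Mills mass gap is NOT proved by any of this.  No `sorry`, no `instance`, no `notation`, no `def`.
-/

noncomputable section

open MeasureTheory

namespace Summit.QuantumFields.YangMills.Theorems.PortZD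

open Literature.MathematicalPhysics.QuantumFieldTheory.Balaban1983to89
open Literature.MathematicalPhysics.QuantumFieldTheory.Balaban1983to89.Node00
open Literature.MathematicalPhysics.QuantumFieldTheory.Balaban1983to89.Node00.ZeroInput
open T4Continuum (T4Family)
open B12Eq019ActionBody (nextAction normConst integrand integrand_apply)
open GaugeField (GaugeInvariant)

/-! ## §1. Cumulant bookkeeping on a probability space: Jensen below, Taylor above -/

section Cumulant

variable {X : Type*} [MeasurableSpace X] {μ : Measure X} [IsProbabilityMeasure μ] {F : X → ℝ}

/-- **JENSEN**: `∫F dμ ≤ log ∫ e^F dμ` on a probability space (`e^x ≥ e^m(1 + x − m)` at `m := ∫F`). [cite: Balaban1988RG2Cluster, p.21 (bookkeeping: first-order perturbation theory)] -/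
theorem jensen_integral_le_log_integral_exp (hF : Integrable F μ) (hexp : Integrable (fun x => Real.exp (F x)) μ) :
    ∫ x, F x ∂μ ≤ Real.log (∫ x, Real.exp (F x) ∂μ) := by
  set m := ∫ x, F x ∂μ with hm
  have hpt : ∀ x, Real.exp m * (F x - m + 1) ≤ Real.exp (F x) := fun x => by
    have h := Real.add_one_le_exp (F x - m)
    have he : Real.exp (F x) = Real.exp m * Real.exp (F x - m) := by rw [← Real.exp_add]; ring_nf
    rw [he]
    exact mul_le_mul_of_nonneg_left h (Real.exp_pos m).le
  have hG : Integrable (fun x => F x - m) μ := hF.sub (integrable_const m)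
  have hI : Integrable (fun x => F x - m + 1) μ := hG.add (integrable_const 1)
  have hone : ∫ x, (F x - m + 1) ∂μ = 1 := by
    rw [integral_add hG (integrable_const 1), integral_sub hF (integrable_const m), integral_const, integral_const]
    simp [hm]
  have hle : Real.exp m ≤ ∫ x, Real.exp (F x) ∂μ := by
    calc Real.exp m = ∫ x, Real.exp m * (F x - m + 1) ∂μ := by rw [integral_const_mul, hone, mul_one]
      _ ≤ ∫ x, Real.exp (F x) ∂μ := integral_mono (hI.const_mul _) hexp hpt
  calc m = Real.log (Real.exp m) := (Real.log_exp m).symm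
    _ ≤ Real.log (∫ x, Real.exp (F x) ∂μ) := Real.log_le_log (Real.exp_pos m) hle

/-- **TAYLOR**: `log ∫ e^F dμ ≤ ∫F dμ + ∫ (F − ∫F)² dμ` when the centred variable is bounded by `1` a.e. (`e^g ≤ 1 + g + g²` for `|g| ≤ 1`, `log y ≤ y − 1`).
[cite: Balaban1988RG2Cluster, p.21 (bookkeeping: second-order remainder)] -/
theorem log_integral_exp_le_integral_add_var (hFm : AEStronglyMeasurable F μ) (hexp : Integrable (fun x => Real.exp (F x)) μ)
    (hb : ∀ᵐ x ∂μ, |F x - ∫ y, F y ∂μ| ≤ 1) :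
    Real.log (∫ x, Real.exp (F x) ∂μ) ≤ (∫ x, F x ∂μ) + ∫ x, (F x - ∫ y, F y ∂μ) ^ 2 ∂μ := by
  set m := ∫ y, F y ∂μ with hm
  -- the centred variable and its square are integrable (bounded a.e.)
  have hGm : AEStronglyMeasurable (fun x => F x - m) μ := hFm.sub aestronglyMeasurable_const
  have hG : Integrable (fun x => F x - m) μ :=
    Integrable.mono' (integrable_const (1 : ℝ)) hGm (by filter_upwards [hb] with x hx; simpa [Real.norm_eq_abs] using hx)
  have hG2 : Integrable (fun x => (F x - m) ^ 2) μ := by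
    refine Integrable.mono' (integrable_const (1 : ℝ)) (hGm.pow 2) ?_
    filter_upwards [hb] with x hx
    rw [Real.norm_eq_abs, abs_of_nonneg (sq_nonneg _)]
    have h1 : |F x - m| ^ 2 ≤ 1 := by nlinarith [abs_nonneg (F x - m)]
    simpa [sq_abs] using h1
  have hF : Integrable F μ := by
    have h := hG.add (integrable_const m)
    refine h.congr (Filter.Eventually.of_forall fun x => ?_)
    simp
  have hG0 : ∫ x, (F x - m) ∂μ = 0 := by
    rw [integral_sub hF (integrable_const m), integral_const]; simp [hm]
  -- `e^{F − m}` is integrable and `∫ e^F = e^m ∫ e^{F−m}`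
  have hexpG : Integrable (fun x => Real.exp (F x - m)) μ := by
    have h := hexp.const_mul (Real.exp (-m))
    refine h.congr (Filter.Eventually.of_forall fun x => ?_)
    show Real.exp (-m) * Real.exp (F x) = Real.exp (F x - m)
    rw [← Real.exp_add]; ring_nf
  have hsplit : ∫ x, Real.exp (F x) ∂μ = Real.exp m * ∫ x, Real.exp (F x - m) ∂μ := by
    rw [← integral_const_mul]
    refine integral_congr_ae (Filter.Eventually.of_forall fun x => ?_)
    show Real.exp (F x) = Real.exp m * Real.exp (F x - m)
    rw [← Real.exp_add]; ring_nf
  -- Taylor: `∫ e^{F−m} ≤ 1 + ∫ (F−m)²`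
  have hT : ∫ x, Real.exp (F x - m) ∂μ ≤ 1 + ∫ x, (F x - m) ^ 2 ∂μ := by
    have h1G : Integrable (fun x => 1 + (F x - m)) μ := (integrable_const 1).add hG
    have h1G2 : Integrable (fun x => 1 + (F x - m) + (F x - m) ^ 2) μ := h1G.add hG2
    calc ∫ x, Real.exp (F x - m) ∂μ ≤ ∫ x, (1 + (F x - m) + (F x - m) ^ 2) ∂μ := by
          refine integral_mono_ae hexpG h1G2 ?_
          filter_upwards [hb] with x hx
          have h := (abs_le.mp (Real.abs_exp_sub_one_sub_id_le hx)).2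
          linarith
      _ = 1 + ∫ x, (F x - m) ^ 2 ∂μ := by
          rw [integral_add h1G hG2, integral_add (integrable_const 1) hG, hG0, integral_const]; simp
  have hpos : 0 < ∫ x, Real.exp (F x - m) ∂μ := integral_exp_pos hexpG
  have hlog : Real.log (∫ x, Real.exp (F x - m) ∂μ) ≤ ∫ x, (F x - m) ^ 2 ∂μ := by
    have := Real.log_le_sub_one_of_pos hpos; linarith
  rw [hsplit, Real.log_mul (Real.exp_pos m).ne' hpos.ne', Real.log_exp]
  linarith

/-- **SECOND-CUMULANT BOOKING**: `|log ∫ e^F dμ − ∫F dμ| ≤ ∫ (F − ∫F)² dμ` under the same hypotheses. [cite: Balaban1988RG2Cluster, p.21 (bookkeeping)] -/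
theorem abs_log_integral_exp_sub_integral_le_var (hFm : AEStronglyMeasurable F μ) (hexp : Integrable (fun x => Real.exp (F x)) μ)
    (hb : ∀ᵐ x ∂μ, |F x - ∫ y, F y ∂μ| ≤ 1) :
    |Real.log (∫ x, Real.exp (F x) ∂μ) - ∫ x, F x ∂μ| ≤ ∫ x, (F x - ∫ y, F y ∂μ) ^ 2 ∂μ := by
  have hF : Integrable F μ := by
    have hG : Integrable (fun x => F x - ∫ y, F y ∂μ) μ :=
      Integrable.mono' (integrable_const (1 : ℝ)) (hFm.sub aestronglyMeasurable_const)
        (by filter_upwards [hb] with x hx; simpa [Real.norm_eq_abs] using hx)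
    exact (hG.add (integrable_const (∫ y, F y ∂μ))).congr (Filter.Eventually.of_forall fun x => by simp)
  have h₁ := jensen_integral_le_log_integral_exp hF hexp
  have h₂ := log_integral_exp_le_integral_add_var hFm hexp hb
  have h₃ : 0 ≤ ∫ x, (F x - ∫ y, F y ∂μ) ^ 2 ∂μ := integral_nonneg (f := fun x => (F x - ∫ y, F y ∂μ) ^ 2) fun x => sq_nonneg _
  rw [abs_le]
  constructor
  · linarith
  · linarith

end Cumulant

/-! ## §2. The normalised fibre law of the `A`-step at `V`, displayed through its defining identity -/

section StepLaw

variable {P : Params} {G : Type*} {k : ℕ} [MeasurableSpace (GaugeField P k G)]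

/-- Under the fibre-law identity `hμ`, `∫ 1 dμ = 1` as soon as the `A`-step's integral at `V` is non-zero. [cite: Balaban1987RG1, (0.19) p.255–256 (bookkeeping)] -/
theorem integral_one_of_stepLaw {T : Density P k G → Density P (k + 1) G} {χ GF : Density P k G} {gk : ℝ} {A : Density P k G}
    {V : GaugeField P (k + 1) G} {μ : Measure (GaugeField P k G)}
    (hμ : ∀ f : Density P k G, ∫ U, f U ∂μ = T (fun U => f U * integrand χ GF gk A U) V / T (integrand χ GF gk A) V)
    (hZ : T (integrand χ GF gk A) V ≠ 0) : ∫ _U, (1 : ℝ) ∂μ = 1 := by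
  have h := hμ (fun _ => 1)
  have hfun : (fun U => (1 : ℝ) * integrand χ GF gk A U) = integrand χ GF gk A := by funext U; rw [one_mul]
  rw [hfun, div_self hZ] at h
  exact h

/-- … so `μ` is a PROBABILITY law. [cite: Balaban1987RG1, (0.19) p.255–256 (bookkeeping)] -/
theorem isProbabilityMeasure_of_stepLaw {T : Density P k G → Density P (k + 1) G} {χ GF : Density P k G} {gk : ℝ} {A : Density P k G}
    {V : GaugeField P (k + 1) G} {μ : Measure (GaugeField P k G)}
    (hμ : ∀ f : Density P k G, ∫ U, f U ∂μ = T (fun U => f U * integrand χ GF gk A U) V / T (integrand χ GF gk A) V)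
    (hZ : T (integrand χ GF gk A) V ≠ 0) : IsProbabilityMeasure μ := by
  have h := integral_one_of_stepLaw hμ hZ
  rw [integral_const, smul_eq_mul, mul_one] at h
  exact ⟨(ENNReal.toReal_eq_one_iff _).1 h⟩

/-- ★ **THE STEP'S MOMENT FUNCTIONAL IS THE EXPONENTIAL MOMENT UNDER THE FIBRE LAW**: `T(I(A + F))(V) ∕ T(I(A))(V) = ∫ e^{F} dμ` (`I(A + F) = e^F · I(A)` pointwise).
[cite: Balaban1987RG1, (2.12)–(2.13) p.268 (bookkeeping)] -/
theorem moment_eq_integral_exp_of_stepLaw {T : Density P k G → Density P (k + 1) G} {χ GF : Density P k G} {gk : ℝ} {A : Density P k G}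
    {V : GaugeField P (k + 1) G} {μ : Measure (GaugeField P k G)}
    (hμ : ∀ f : Density P k G, ∫ U, f U ∂μ = T (fun U => f U * integrand χ GF gk A U) V / T (integrand χ GF gk A) V) (F : Density P k G) :
    T (integrand χ GF gk (A + F)) V / T (integrand χ GF gk A) V = ∫ U, Real.exp (F U) ∂μ := by
  have hfun : (fun U => Real.exp (F U) * integrand χ GF gk A U) = integrand χ GF gk (A + F) := by
    funext U
    rw [integrand_apply, integrand_apply, Pi.add_apply, ← add_assoc, Real.exp_add (-(1 / gk ^ 2) * GF U + A U) (F U)]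
    ring
  rw [hμ, hfun]

/-- **THE FIRST-ORDER TERM**: `T(F·I(A))(V) ∕ T(I(A))(V) = ∫ F dμ` (the fibre expectation of `F`). [cite: Balaban1987RG1, (2.13)–(2.14) p.268 (bookkeeping)] -/
theorem mean_eq_integral_of_stepLaw {T : Density P k G → Density P (k + 1) G} {χ GF : Density P k G} {gk : ℝ} {A : Density P k G}
    {V : GaugeField P (k + 1) G} {μ : Measure (GaugeField P k G)}
    (hμ : ∀ f : Density P k G, ∫ U, f U ∂μ = T (fun U => f U * integrand χ GF gk A U) V / T (integrand χ GF gk A) V) (F : Density P k G) :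
    T (fun U => F U * integrand χ GF gk A U) V / T (integrand χ GF gk A) V = ∫ U, F U ∂μ :=
  (hμ F).symm

/-- ★ **SECOND-CUMULANT BOOKING OF THE LOG-MOMENT**: `|log[T(I(A + F))(V) ∕ T(I(A))(V)] − ∫F dμ| ≤ ∫ (F − ∫F dμ)² dμ` when the `A`-step is defined at `V`, `e^F ∈ L¹(μ)` and the
centred bracket is bounded by `1` `μ`-a.e. [cite: Balaban1988RG2Cluster, Lemma 3 (2.38) p.20, p.21 (mechanism; bookkeeping)] -/
theorem abs_log_moment_sub_mean_le_var_of_stepLaw {T : Density P k G → Density P (k + 1) G} {χ GF : Density P k G} {gk : ℝ} {A : Density P k G}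
    {V : GaugeField P (k + 1) G} {μ : Measure (GaugeField P k G)}
    (hμ : ∀ f : Density P k G, ∫ U, f U ∂μ = T (fun U => f U * integrand χ GF gk A U) V / T (integrand χ GF gk A) V)
    (hZ : T (integrand χ GF gk A) V ≠ 0) (F : Density P k G) (hFm : AEStronglyMeasurable F μ) (hexp : Integrable (fun U => Real.exp (F U)) μ)
    (hb : ∀ᵐ U ∂μ, |F U - ∫ U', F U' ∂μ| ≤ 1) :
    |Real.log (T (integrand χ GF gk (A + F)) V / T (integrand χ GF gk A) V) - ∫ U, F U ∂μ| ≤ ∫ U, (F U - ∫ U', F U' ∂μ) ^ 2 ∂μ := by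
  haveI := isProbabilityMeasure_of_stepLaw hμ hZ
  rw [moment_eq_integral_exp_of_stepLaw hμ F]
  exact abs_log_integral_exp_sub_integral_le_var hFm hexp hb

/-- Under the fibre law the `(A + F)`-step's integral at `V` is `T(I(A))(V) · ∫ e^F dμ`, hence POSITIVE with `T(I(A))(V)` (`e^F ∈ L¹(μ)`).
[cite: Balaban1987RG1, (0.19) p.255 (bookkeeping)] -/
theorem transport_integrand_add_pos_of_stepLaw {T : Density P k G → Density P (k + 1) G} {χ GF : Density P k G} {gk : ℝ} {A : Density P k G}
    {V : GaugeField P (k + 1) G} {μ : Measure (GaugeField P k G)}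
    (hμ : ∀ f : Density P k G, ∫ U, f U ∂μ = T (fun U => f U * integrand χ GF gk A U) V / T (integrand χ GF gk A) V)
    (hZ : 0 < T (integrand χ GF gk A) V) (F : Density P k G) (hexp : Integrable (fun U => Real.exp (F U)) μ) :
    0 < T (integrand χ GF gk (A + F)) V := by
  haveI := isProbabilityMeasure_of_stepLaw hμ hZ.ne'
  have h := moment_eq_integral_exp_of_stepLaw hμ F
  have hpos : 0 < ∫ U, Real.exp (F U) ∂μ := integral_exp_pos hexp
  have heq : T (integrand χ GF gk (A + F)) V = T (integrand χ GF gk A) V * ∫ U, Real.exp (F U) ∂μ := by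
    rw [← h, mul_div_cancel₀ _ hZ.ne']
  rw [heq]
  exact mul_pos hZ hpos

end StepLaw

/-! ## §3. The history channel equals its first-order value up to the two second cumulants -/

variable (F : T4Family) (N : ℕ) [NeZero N]

/-- ★★ **THE HISTORY RESPONSE IS FIRST ORDER IN THE BRACKET UP TO SECOND CUMULANTS**: `T K k` degree-one homogeneous; `μW`, `μ1` the fibre laws of the `A`-step at `W` and at `1`
(displayed through `hμW`, `hμ1`); the `A`-step defined at `W` and `1`; the centred brackets `E − E(bg_V) − ⟨…⟩` bounded by `1` a.e. and `e^{E − E(bg_V)}` integrable (`V = W, 1`).  Then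
`|R_k(A + E)(W) − R_k(A)(W) + E(bg_1) − (⟨E − E(bg_W)⟩_{μW} − ⟨E − E(bg_1)⟩_{μ1})| ≤ Var_{μW} + Var_{μ1}`.
[cite: Balaban1987RG1, (1.6) p.261, (2.12)–(2.14) p.268; Balaban1988RG2Cluster, Lemma 3 (2.38) p.20, p.21] -/
theorem abs_stepOutT_add_sub_sub_firstOrder_le_var (T : Transport F N) (χ : (K : ℕ) → (ℕ → ℝ) → (k : ℕ) → Density (F.P K) k (SU N)) (ε : ℝ)
    (K : ℕ) (g : ℕ → ℝ) (k : ℕ) (hT : ∀ (a : ℝ) (ρ : Density (F.P K) k (SU N)), T K k (fun U => a * ρ U) = fun V => a * T K k ρ V)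
    (A E : Density (F.P K) k (SU N)) (W : GaugeField (F.P K) (k + 1) (SU N)) {μW μ1 : Measure (GaugeField (F.P K) k (SU N))}
    (hμW : ∀ f : Density (F.P K) k (SU N),
      ∫ U, f U ∂μW = T K k (fun U => f U * integrand (χ K g k) (gfOfRecord F N K k) (g k) A U) W / T K k (integrand (χ K g k) (gfOfRecord F N K k) (g k) A) W)
    (hμ1 : ∀ f : Density (F.P K) k (SU N),
      ∫ U, f U ∂μ1 = T K k (fun U => f U * integrand (χ K g k) (gfOfRecord F N K k) (g k) A U) 1 / T K k (integrand (χ K g k) (gfOfRecord F N K k) (g k) A) 1)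
    (hAW : 0 < T K k (integrand (χ K g k) (gfOfRecord F N K k) (g k) A) W)
    (hA1 : 0 < T K k (integrand (χ K g k) (gfOfRecord F N K k) (g k) A) 1)
    (hmW : AEStronglyMeasurable (fun U => E U - E (Averaging.iter (avOfRecord F N K) k (Uk F N K (k + 1) ε W))) μW)
    (hm1 : AEStronglyMeasurable (fun U => E U - E (Averaging.iter (avOfRecord F N K) k (Uk F N K (k + 1) ε 1))) μ1)
    (heW : Integrable (fun U => Real.exp (E U - E (Averaging.iter (avOfRecord F N K) k (Uk F N K (k + 1) ε W)))) μW)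
    (he1 : Integrable (fun U => Real.exp (E U - E (Averaging.iter (avOfRecord F N K) k (Uk F N K (k + 1) ε 1)))) μ1)
    (hbW : ∀ᵐ U ∂μW, |E U - E (Averaging.iter (avOfRecord F N K) k (Uk F N K (k + 1) ε W)) -
      ∫ U', (E U' - E (Averaging.iter (avOfRecord F N K) k (Uk F N K (k + 1) ε W))) ∂μW| ≤ 1)
    (hb1 : ∀ᵐ U ∂μ1, |E U - E (Averaging.iter (avOfRecord F N K) k (Uk F N K (k + 1) ε 1)) -
      ∫ U', (E U' - E (Averaging.iter (avOfRecord F N K) k (Uk F N K (k + 1) ε 1))) ∂μ1| ≤ 1) :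
    |stepOutT F N T χ ε K g k (A + E) W - stepOutT F N T χ ε K g k A W + E (Averaging.iter (avOfRecord F N K) k (Uk F N K (k + 1) ε 1)) -
        ((∫ U, (E U - E (Averaging.iter (avOfRecord F N K) k (Uk F N K (k + 1) ε W))) ∂μW) -
          ∫ U, (E U - E (Averaging.iter (avOfRecord F N K) k (Uk F N K (k + 1) ε 1))) ∂μ1)| ≤
      (∫ U, (E U - E (Averaging.iter (avOfRecord F N K) k (Uk F N K (k + 1) ε W)) -
          ∫ U', (E U' - E (Averaging.iter (avOfRecord F N K) k (Uk F N K (k + 1) ε W))) ∂μW) ^ 2 ∂μW) +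
      ∫ U, (E U - E (Averaging.iter (avOfRecord F N K) k (Uk F N K (k + 1) ε 1)) -
          ∫ U', (E U' - E (Averaging.iter (avOfRecord F N K) k (Uk F N K (k + 1) ε 1))) ∂μ1) ^ 2 ∂μ1 := by
  set cW := E (Averaging.iter (avOfRecord F N K) k (Uk F N K (k + 1) ε W)) with hcW
  set c1 := E (Averaging.iter (avOfRecord F N K) k (Uk F N K (k + 1) ε 1)) with hc1
  -- the two `(A + E)`-steps are defined: `T(I(A+E))(V) = e^{c_V} · T(I(A + (E − c_V)))(V) > 0`
  have hXW : 0 < T K k (integrand (χ K g k) (gfOfRecord F N K k) (g k) (A + fun U => E U - cW)) W :=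
    transport_integrand_add_pos_of_stepLaw hμW hAW _ heW
  have hX1 : 0 < T K k (integrand (χ K g k) (gfOfRecord F N K k) (g k) (A + fun U => E U - c1)) 1 :=
    transport_integrand_add_pos_of_stepLaw hμ1 hA1 _ he1
  have hEW : 0 < T K k (integrand (χ K g k) (gfOfRecord F N K k) (g k) (A + E)) W := by
    rw [transport_integrand_add_recentre hT _ _ _ A E cW W]; exact mul_pos (Real.exp_pos _) hXW
  have hE1 : 0 < T K k (integrand (χ K g k) (gfOfRecord F N K k) (g k) (A + E)) 1 := by
    rw [transport_integrand_add_recentre hT _ _ _ A E c1 1]; exact mul_pos (Real.exp_pos _) hX1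
  rw [stepOutT_add_sub_eq_log_fluct F N T χ ε K g k hT A E W hAW hA1 hEW hE1, sub_add_cancel]
  have h₁ := abs_log_moment_sub_mean_le_var_of_stepLaw hμW hAW.ne' (fun U => E U - cW) hmW heW hbW
  have h₂ := abs_log_moment_sub_mean_le_var_of_stepLaw hμ1 hA1.ne' (fun U => E U - c1) hm1 he1 hb1
  -- `|(a − b) − (m − n)| ≤ |a − m| + |b − n|`
  have key : ∀ a b m n : ℝ, |a - b - (m - n)| ≤ |a - m| + |b - n| := fun a b m n => by
    calc |a - b - (m - n)| = |(a - m) - (b - n)| := by ring_nf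
      _ ≤ |a - m| + |b - n| := abs_sub _ _
  exact (key _ _ _ _).trans (add_le_add h₁ h₂)

/-- ★★ **THE HISTORY CHANNEL EQUALS ITS FIRST-ORDER PERTURBATIVE VALUE UP TO SECOND CUMULANTS**: with `A := A⁰_k`, `E := 𝐄_k`, `GaugeInvariant A_k` (unit normalisation, displayed),
`μW`, `μ1` the fibre laws of the ZERO-INPUT step at `W` and at `1`:
`|𝓓_{k+1}(W) − (⟨𝐄_k − 𝐄_k(bg_W)⟩⁰_W − ⟨𝐄_k⟩⁰_1)| ≤ Var⁰_W(𝐄_k) + Var⁰_1(𝐄_k)` — the zero-input fibre expectation of print's curly bracket is the first-order term of (2.13)'s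
expansion, the two variances carry everything beyond it (`ε > 0`, `k + 1 ≤ m + K`; the zero-input step defined at `W`, `1`; centred brackets `≤ 1` a.e., exponential moments finite).
[cite: Balaban1987RG1, (1.6) p.261, (2.12)–(2.14) p.268, (2.16) p.269; Balaban1988RG2Cluster, Lemma 3 (2.38) p.20, p.21] -/
theorem abs_dChannel_sub_firstOrder_le_var (T : Transport F N) (χ : (K : ℕ) → (ℕ → ℝ) → (k : ℕ) → Density (F.P K) k (SU N)) {ε : ℝ} (hε : 0 < ε)
    {K : ℕ} (g : ℕ → ℝ) {k : ℕ} (hk : k + 1 ≤ (F.P K).m + (F.P K).K)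
    (hT : ∀ (a : ℝ) (ρ : Density (F.P K) k (SU N)), T K k (fun U => a * ρ U) = fun V => a * T K k ρ V)
    (hinv : GaugeInvariant (effActionHT F N T χ K g k)) (W : GaugeField (F.P K) (k + 1) (SU N)) {μW μ1 : Measure (GaugeField (F.P K) k (SU N))}
    (hμW : ∀ f : Density (F.P K) k (SU N),
      ∫ U, f U ∂μW = T K k (fun U => f U * integrand (χ K g k) (gfOfRecord F N K k) (g k) (mainTermT F N ε K g k) U) W /
        T K k (integrand (χ K g k) (gfOfRecord F N K k) (g k) (mainTermT F N ε K g k)) W)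
    (hμ1 : ∀ f : Density (F.P K) k (SU N),
      ∫ U, f U ∂μ1 = T K k (fun U => f U * integrand (χ K g k) (gfOfRecord F N K k) (g k) (mainTermT F N ε K g k) U) 1 /
        T K k (integrand (χ K g k) (gfOfRecord F N K k) (g k) (mainTermT F N ε K g k)) 1)
    (h0W : 0 < T K k (integrand (χ K g k) (gfOfRecord F N K k) (g k) (mainTermT F N ε K g k)) W)
    (h01 : 0 < T K k (integrand (χ K g k) (gfOfRecord F N K k) (g k) (mainTermT F N ε K g k)) 1)
    (hmW : AEStronglyMeasurable (fun U => EkT F N T χ ε K g k U - EkT F N T χ ε K g k (Averaging.iter (avOfRecord F N K) k (Uk F N K (k + 1) ε W))) μW)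
    (hm1 : AEStronglyMeasurable (EkT F N T χ ε K g k) μ1)
    (heW : Integrable (fun U => Real.exp (EkT F N T χ ε K g k U - EkT F N T χ ε K g k (Averaging.iter (avOfRecord F N K) k (Uk F N K (k + 1) ε W)))) μW)
    (he1 : Integrable (fun U => Real.exp (EkT F N T χ ε K g k U)) μ1)
    (hbW : ∀ᵐ U ∂μW, |EkT F N T χ ε K g k U - EkT F N T χ ε K g k (Averaging.iter (avOfRecord F N K) k (Uk F N K (k + 1) ε W)) -
      ∫ U', (EkT F N T χ ε K g k U' - EkT F N T χ ε K g k (Averaging.iter (avOfRecord F N K) k (Uk F N K (k + 1) ε W))) ∂μW| ≤ 1)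
    (hb1 : ∀ᵐ U ∂μ1, |EkT F N T χ ε K g k U - ∫ U', EkT F N T χ ε K g k U' ∂μ1| ≤ 1) :
    |mergedTermT F N T χ ε K g k W - zeroInputMergedTermT F N T χ ε K g k W -
        ((∫ U, (EkT F N T χ ε K g k U - EkT F N T χ ε K g k (Averaging.iter (avOfRecord F N K) k (Uk F N K (k + 1) ε W))) ∂μW) -
          ∫ U, EkT F N T χ ε K g k U ∂μ1)| ≤
      (∫ U, (EkT F N T χ ε K g k U - EkT F N T χ ε K g k (Averaging.iter (avOfRecord F N K) k (Uk F N K (k + 1) ε W)) -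
          ∫ U', (EkT F N T χ ε K g k U' - EkT F N T χ ε K g k (Averaging.iter (avOfRecord F N K) k (Uk F N K (k + 1) ε W))) ∂μW) ^ 2 ∂μW) +
      ∫ U, (EkT F N T χ ε K g k U - ∫ U', EkT F N T χ ε K g k U' ∂μ1) ^ 2 ∂μ1 := by
  have h0 := EkT_iter_Uk_one_of_gaugeInvariant F N T χ hε g hk hinv
  have h := abs_stepOutT_add_sub_sub_firstOrder_le_var F N T χ ε K g k hT (mainTermT F N ε K g k) (EkT F N T χ ε K g k) W hμW hμ1 h0W h01
    hmW (by simpa only [h0, sub_zero] using hm1) heW (by simpa only [h0, sub_zero] using he1) hbW (by simpa only [h0, sub_zero] using hb1)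
  simpa only [h0, sub_zero, add_zero, ← effActionHT_eq_main_add_Ek_fun, ← mergedTermT_eq_stepOut, ← zeroInputMergedTermT_eq_stepOut] using h

end Summit.QuantumFields.YangMills.Theorems.PortZD

end
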